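import Literature.NumberTheory.LFunctions.CriticalZerosDirichletFamily
import HarnessLib

/-!
# Wu (2019), Theorem 2: more than `41.72%` of the zeros of EVERY Dirichlet `L`-function are on the
# critical line (`40.74%` simple), uniformly for `log q = o(log T)`

LABEL (cell `landau-siegel`, §C literature harvest, topic r5 = Levinson–Conrey records; bears_on F-S3
§C): the single-character record (the `L(s,χ)` analogue of the `5/12`-era records for `ζ`), with
its printed uniformity `log q = o(log T)` — i.e. heights far ABOVE the conductor; nothing is claimed
at heights `T ≤ q^{O(1)}`. «The programme SEARCHES and TYPES; no claim about Landau–Siegel zeros,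
Theorems 1–2 of arXiv:2211.02515 or a repaired Margin232 until a kernel theorem says so.»

Topic `Literature/NumberTheory/LFunctions` (namespace `Literature.NumberTheory.LFunctions`; the
critical count with multiplicity in the sub-namespace `WuCriticalZeros`), continuing
`CriticalZerosDirichletFamily.lean`, whose single-character counts `CISCriticalZeros.zeroCount χ T`
(`N(T,χ)`, zeros `0 < β < 1`, `|γ| ≤ T`, with multiplicity) and
`CISCriticalZeros.simpleCriticalZeroCount χ T` (`N₀*`) are CITED (same conventions as Wu's).
STATEMENT LAYER (D-0014): ONE named fact (Theorem 2).

## What the source prints (held text `paper:arxiv-1802.09704`, corpus-tex chunks p0004–p0005,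
## p0019, read 2026-08-26)

X. Wu, *The twisted mean square and critical zeros of Dirichlet L-functions*, Math. Z. **293**
(2019) 825–865 = arXiv:1802.09704 [Wu2019TwistedMeanSquare].

p0004: «Let `N(T,χ)` denote the number of zeros of `L(s,χ)`, `ρ = β + iγ′`, with `|γ′| ≤ T` counted
with multiplicity. Also let `N₀(T,χ)` denote the number of such critical zeros with `β = 1/2`, and
`N₀*(T,χ)` denote the number of such critical zeros with `β = 1/2` and being simple. Define
`κ(χ) = N₀(T,χ)/N(T,χ)`, `κ*(χ) = N₀*(T,χ)/N(T,χ)`.»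

> **Theorem 2.** We have, for any Dirichlet character `χ`,
> `κ(χ) > .4172` and `κ*(χ) > .4074`
> uniformly in `q` with `log q = o(log T)` for sufficiently large `T`.

«Remark. We do not need to restrict this theorem to primitive characters since Dirichlet
L-functions to non-primitive characters share the same non-trivial zeros as ones to corresponding
primitive characters.» Proof (§5, p0019): Levinson–Conrey with the mollifier coefficients
`a(n) = μ(n)(P₁(log(y/n)/log y) + P₂(·) Σ_{p∣n, p ≤ y^{3/4}} P(log p/log y))`, `y = T^θ`,
`θ = 4/7 − ε` (Theorem 1 (B)), `R = 1.3` (resp. `1.116`), printed `Q, P₁, P₂, P` (Mathematica);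
Remark p0019: with `K = 3` Feng-type pieces `κ(χ) > .417277`, `κ*(χ) > .407475`.

## Lean rendering / design choices (audit notes for ls-lit-ref)

* `N(T,χ)`, `N₀*(T,χ)`: the tree's `CISCriticalZeros.zeroCount` / `simpleCriticalZeroCount`
  (`|γ| ≤ T`, multiplicity `DirichletDisc.zeroOrder`), exactly Wu's conventions; `N₀(T,χ)` (critical,
  WITH multiplicity) is `WuCriticalZeros.criticalZeroCount`, defined here on the same pattern.
* «for any Dirichlet character `χ`» — all `χ` mod `q`, `q ≥ 1` (imprimitive and principal
  included, as the Remark says; Mathlib's `LFunction` of an imprimitive character has its extra zeros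
  on `Re s = 0`, outside the counted strip, and the principal character mod `q` gives the zeros of
  `ζ`, for which `.4172 < .41729` is also in print).
* «uniformly in `q` with `log q = o(log T)` for sufficiently large `T`»: for every admissible growth
  function `g` with `g(T)/log T → 0` there is `T₀ = T₀(g)` beyond which the bounds hold for all
  moduli `q` with `log q ≤ g(T)` and all `χ` mod `q` (the standard reading of a `o(·)`-uniformity;
  typed with `∀ g, Tendsto (g/log) atTop (𝓝 0) → ∃ T₀, …`).
* `κ(χ) > .4172` (a `T`-dependent ratio, strict) is typed as the non-strict `0.4172·N ≤ N₀` (what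
  the printed strict inequality implies; the printed value is a rounding-down of the computed one).
  The constants are uncertified floating-point outcomes, typed verbatim.

## References

* X. Wu, Math. Z. 293 (2019) 825–865, arXiv:1802.09704: §1 Theorem 1, Theorem 2 and Remarks; §5.
  [Wu2019TwistedMeanSquare]
* Tree: `CriticalZerosDirichletFamily.lean` (Conrey–Iwaniec–Soundararajan 2013 vocabulary),
  `ZeroCounting.lean` (`przz_bound`, the `ζ` record). [ConreyIwaniecSoundararajan2011CriticalZeros]
-/

noncomputable section

open scoped Classical
open Complex Filter Set Topology

namespace Literature.NumberTheory.LFunctions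

namespace WuCriticalZeros

variable {q : ℕ} [NeZero q]

/-- `N₀(T,χ)` of Wu: the zeros `ρ = ½ + iγ′` of `L(s,χ)` with `|γ′| ≤ T`, counted WITH multiplicity
(`finsum` of `DirichletDisc.zeroOrder χ ρ` over the tree's non-trivial zeros on the critical line
with `|Im ρ| ≤ T`). [cite: Wu2019TwistedMeanSquare, §1 (definition of N₀(T,χ), before Thm 2)] -/
def criticalZeroCount (χ : DirichletCharacter ℂ q) (T : ℝ) : ℕ :=
  ∑ᶠ ρ ∈ {ρ : ℂ | ρ ∈ ExplicitPsiChar.charNontrivialZeros χ ∧ ρ.re = 1 / 2 ∧ |ρ.im| ≤ T},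
    DirichletDisc.zeroOrder χ ρ

/-- The critical zeros with `|γ′| ≤ T` are among the zeros counted by `N(T,χ)` (so `N₀ ≤ N`
termwise). [cite: Wu2019TwistedMeanSquare, §1 (definitions before Thm 2)] -/
theorem criticalZeros_subset (χ : DirichletCharacter ℂ q) (T : ℝ) :
    {ρ : ℂ | ρ ∈ ExplicitPsiChar.charNontrivialZeros χ ∧ ρ.re = 1 / 2 ∧ |ρ.im| ≤ T} ⊆
      {ρ : ℂ | ρ ∈ ExplicitPsiChar.charNontrivialZeros χ ∧ |ρ.im| ≤ T} :=
  fun _ h ↦ ⟨h.1, h.2.2⟩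

end WuCriticalZeros

/-- **Wu 2019, Theorem 2** (Levinson–Conrey for an individual Dirichlet `L`-function with a
Conrey + small-prime Feng-type mollifier of length `T^{4/7−ε}`; numerics not certified here). For
every growth function `g` with `g(T) = o(log T)` there is `T₀` such that for all `T ≥ T₀`, all
moduli `q ≥ 1` with `log q ≤ g(T)` and ALL Dirichlet characters `χ (mod q)`:
`N₀(T,χ) ≥ 0.4172 · N(T,χ)` and `N₀*(T,χ) ≥ 0.4074 · N(T,χ)`
(`N` = zeros with `0 < β < 1`, `|γ| ≤ T`, with multiplicity; `N₀` critical with multiplicity; `N₀*`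
simple critical). Printed: «`κ(χ) > .4172` and `κ*(χ) > .4074` uniformly in `q` with
`log q = o(log T)` for sufficiently large `T`» (with `K = 3` pieces: `.417277`, `.407475`). Status:
theorem-in-print (named fact). [cite: Wu2019TwistedMeanSquare, Theorem 2] -/
def wu2019_theorem2 : Prop :=
  ∀ g : ℝ → ℝ, Tendsto (fun T ↦ g T / Real.log T) atTop (𝓝 0) →
    ∃ T₀ : ℝ, ∀ T : ℝ, T₀ ≤ T →
      ∀ (q : ℕ) [NeZero q], Real.log q ≤ g T →
        ∀ χ : DirichletCharacter ℂ q,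
          (0.4172 : ℝ) * (CISCriticalZeros.zeroCount χ T : ℝ) ≤
              WuCriticalZeros.criticalZeroCount χ T ∧
          (0.4074 : ℝ) * (CISCriticalZeros.zeroCount χ T : ℝ) ≤
              CISCriticalZeros.simpleCriticalZeroCount χ T

end Literature.NumberTheory.LFunctions
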